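import Mathlib
import HarnessLib
import Summits.NavierStokesRegularity.NavierStokesRegularity.Theorems.PoloidalWindowDoorPoloidalWindowRigidityZShockSlopeFunctionSpaceTime

/-!
# Crux K2 `PoloidalWindowRigidity` (stmt-NavierStokesRegularity-19708), line `z_shock` — the SLAB-MINORS predicate is an Aut clause:
# entry to the (SF) bridges B1–B3 from «autonomy minors ≡ 0 on the backward slab» (no slope function assumed)

`--supports stmt-NavierStokesRegularity-19708 --as helper` (leafhand-ns-poloidalwindowdoor-3 g13, cell decomp-ns, 2026-08-31).  Def-free.
**No stub and no summit is closed by this file; Navier–Stokes regularity is NOT proved here (rung 0).**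

The bridges B1–B3 of this hand (`…ZShockSlopeFunctionSpaceTime`, `…PressureLocal`, `…SourceLocal`, `…ClebschTransport`, `…SFReduction`) are
entered through the registered stub's LOCAL AUTONOMY CLAUSE (`∃ g W₁ ∋ z₀, ∂_z v_b = g(t,v₂)∂_b v₂ on W₁`, skeleton v3 c3e8eee2), which they
use only through g12's consequence «all autonomy minors vanish on the whole slab» (`…ZShockAutonomySlab.minors_eq_zero_on_slab_of_class_autonomy`).
g12 also showed that the minors predicate is a GLOBAL alternative for a class profile (`minor_zero_or_dense_ne`: each minor is ≡ 0 on the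
slab or non-zero on an open dense subset) and drafted a re-cut (v4) by SLICE-wise minors.  NOTE for the planner: the Navier–Stokes
identities of (SF) need the slope function to be differentiable IN TIME, i.e. SPACE–TIME autonomy; slice-wise minors at one time do not
give it.  The right analytic predicate for a dynamics-facing re-cut is therefore «minors ≡ 0 on the SLAB» (AutS) versus «some minor ≠ 0 on
an open dense subset of the slab» (ModS), and this file shows AutS is exactly as strong as the v3 clause:

* `slopeFunction_spaceTime_of_slab_minors` — B1 from AutS: class binders + divergence-free + poloidal + AutS ⟹ near every slab point off
  `{∇ₕv₂ = 0}` a slope function jointly real-analytic in `(t, v₂)` on an open space–time neighbourhood (same proof as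
  `…SlopeFunctionSpaceTime.slopeFunction_spaceTime_of_class_autonomy`, the minors fed directly);
* ★ `autClause_of_slab_minors` — AutS + one slab point with `∇ₕv₂ ≠ 0` ⟹ the v3 LOCAL AUTONOMY CLAUSE on an open nonempty `W₁` of the
  slab containing that point (so every theorem of the B1–B3 chain, `…SFReduction` and `…ThickOfNotTV` applies verbatim under AutS).

presearch: n/a (tree-internal). [folklore]
-/

noncomputable section

namespace Summit.NavierStokesRegularity.NavierStokesRegularity.Theorems.PoloidalWindowDoorPoloidalWindowRigidityZShockSlabMinorsAut

-- the problem directory repeats the summit name (`NavierStokesRegularity/NavierStokesRegularity`)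
set_option linter.dupNamespace false

open Set Filter Topology Function Metric
open scoped RealInnerProductSpace InnerProductSpace ContDiff
open Literature.Analysis Literature.Analysis.FluidPDE
open Summit.NavierStokesRegularity.NavierStokesRegularity.Theorems.LocalSineTubeDoorProfileAlignedWindowRigidityAncient
open Summit.NavierStokesRegularity.NavierStokesRegularity.Theorems.PoloidalWindowDoorPoloidalWindowRigidityK2OfLrcSlope
open Summit.NavierStokesRegularity.NavierStokesRegularity.Theorems.PoloidalWindowDoorPoloidalWindowRigidityZShockThInstantSlope
open Summit.NavierStokesRegularity.NavierStokesRegularity.Theorems.PoloidalWindowDoorPoloidalWindowRigidityZShockSlopeFunctionSpaceTime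

/-- **B1 from the slab-minors predicate (AutS).**  Class binders (Type-I rate, continuity, Oseen identity, divergence-free, poloidal) and
«all autonomy minors vanish on the backward slab» ⟹ for every `t₀ < 0`, `x₀` with `∇ₕv₂(t₀,x₀) ≠ 0`: a slope function `m` with `uncurry m`
real-analytic at `(t₀, v₂(t₀,x₀))` and an open `O ∋ (t₀,x₀)` in the slab with `∂_z v_b = m(t,v₂)∂_b v₂` on `O`, both `b ≠ 2`. [folklore] -/
theorem slopeFunction_spaceTime_of_slab_minors (C : ℝ) (v : ℝ → EuclideanSpace ℝ (Fin 3) → EuclideanSpace ℝ (Fin 3))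
    (hrate : Literature.Analysis.FluidPDE.HasTypeITimeDecay C v)
    (hcont : ContinuousOn (Function.uncurry v) (Set.Iio (0 : ℝ) ×ˢ Set.univ))
    (hmild : ∀ s t : ℝ, s < t → t < 0 → ∀ x, v t x =
      Literature.Analysis.UnboundedOperators.heatExtension (v s) (t - s) x -
        Literature.Analysis.FluidPDE.oseenDuhamel 1 s v v t x)
    (hdiv : ∀ t < 0, Literature.Analysis.FluidPDE.VectorCalculus.IsDivFree (v t))
    (hpol : ∀ s < 0, ∀ y, ⟪Literature.Analysis.FluidPDE.curl (v s) y, EuclideanSpace.single 2 1⟫_ℝ = 0)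
    (hmin : ∀ t < 0, ∀ b : Fin 3, b ≠ 2 → ∀ x p q : EuclideanSpace ℝ (Fin 3),
      (fderiv ℝ (v t) x (EuclideanSpace.single b 1) 2 *
            fderiv ℝ (fun y => fderiv ℝ (v t) y (EuclideanSpace.single 2 1) b) x p -
          fderiv ℝ (v t) x (EuclideanSpace.single 2 1) b *
            fderiv ℝ (fun y => fderiv ℝ (v t) y (EuclideanSpace.single b 1) 2) x p) *
          fderiv ℝ (fun y => v t y 2) x q -
        (fderiv ℝ (v t) x (EuclideanSpace.single b 1) 2 *
            fderiv ℝ (fun y => fderiv ℝ (v t) y (EuclideanSpace.single 2 1) b) x q -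
          fderiv ℝ (v t) x (EuclideanSpace.single 2 1) b *
            fderiv ℝ (fun y => fderiv ℝ (v t) y (EuclideanSpace.single b 1) 2) x q) *
          fderiv ℝ (fun y => v t y 2) x p = 0)
    {t₀ : ℝ} (ht₀ : t₀ < 0) {x₀ : EuclideanSpace ℝ (Fin 3)}
    (hx₀ : fderiv ℝ (v t₀) x₀ (EuclideanSpace.single 0 1) 2 ≠ 0 ∨ fderiv ℝ (v t₀) x₀ (EuclideanSpace.single 1 1) 2 ≠ 0) :
    ∃ m : ℝ → ℝ → ℝ, ContDiffAt ℝ ω (Function.uncurry m) (t₀, v t₀ x₀ 2) ∧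
      ∃ O : Set (ℝ × EuclideanSpace ℝ (Fin 3)), IsOpen O ∧ (t₀, x₀) ∈ O ∧ O ⊆ Set.Iio (0 : ℝ) ×ˢ Set.univ ∧
        ∀ z ∈ O, ∀ b : Fin 3, b ≠ 2 →
          fderiv ℝ (v z.1) z.2 (EuclideanSpace.single 2 1) b =
            m z.1 (v z.1 z.2 2) * fderiv ℝ (v z.1) z.2 (EuclideanSpace.single b 1) 2 := by
  -- ## the pivot index `b₀` with `∂_{b₀} v₂(t₀,x₀) ≠ 0` and the other horizontal index `b₁`
  obtain ⟨b₀, b₁, hb₀, hb₁, hb01, hpiv, hcover⟩ : ∃ b₀ b₁ : Fin 3, b₀ ≠ 2 ∧ b₁ ≠ 2 ∧ b₀ ≠ b₁ ∧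
      fderiv ℝ (v t₀) x₀ (EuclideanSpace.single b₀ 1) 2 ≠ 0 ∧ ∀ b : Fin 3, b ≠ 2 → b = b₀ ∨ b = b₁ := by
    rcases hx₀ with h | h
    · exact ⟨0, 1, by decide, by decide, by decide, h, fun b hb => by fin_cases b <;> simp_all⟩
    · exact ⟨1, 0, by decide, by decide, by decide, h, fun b hb => by fin_cases b <;> simp_all⟩
  -- ## the space–time data
  have hSo : IsOpen (Set.Iio (0 : ℝ) ×ˢ (Set.univ : Set (EuclideanSpace ℝ (Fin 3)))) := isOpen_Iio.prod isOpen_univ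
  have haS : (t₀, x₀) ∈ Set.Iio (0 : ℝ) ×ˢ (Set.univ : Set (EuclideanSpace ℝ (Fin 3))) :=
    Set.mk_mem_prod ht₀ (Set.mem_univ _)
  set N : ℝ × EuclideanSpace ℝ (Fin 3) → ℝ := fun z => fderiv ℝ (v z.1) z.2 (EuclideanSpace.single 2 1) b₀ with hN
  set D : ℝ × EuclideanSpace ℝ (Fin 3) → ℝ := fun z => fderiv ℝ (v z.1) z.2 (EuclideanSpace.single b₀ 1) 2 with hD
  set W : ℝ × EuclideanSpace ℝ (Fin 3) → ℝ := fun z => v z.1 z.2 2 with hW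
  have hanV : AnalyticOnNhd ℝ (uncurry v) (Set.Iio (0 : ℝ) ×ˢ Set.univ) := analyticOnNhd_uncurry hcont (bdd_of_hasTypeITimeDecay hrate) hmild
  have hNan : AnalyticOnNhd ℝ N (Set.Iio (0 : ℝ) ×ˢ Set.univ) := analyticOnNhd_uncurry_fderiv_entry hrate hcont hmild 2 b₀
  have hDan : AnalyticOnNhd ℝ D (Set.Iio (0 : ℝ) ×ˢ Set.univ) := analyticOnNhd_uncurry_fderiv_entry hrate hcont hmild b₀ 2
  have hWan : AnalyticOnNhd ℝ W (Set.Iio (0 : ℝ) ×ˢ Set.univ) := by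
    have e : W = (EuclideanSpace.proj (2 : Fin 3) : EuclideanSpace ℝ (Fin 3) →L[ℝ] ℝ) ∘ uncurry v := by
      funext z; rfl
    rw [e]
    exact (EuclideanSpace.proj (2 : Fin 3)).comp_analyticOnNhd hanV
  -- slices are differentiable
  have hsd : ∀ {t : ℝ}, t < 0 → ∀ y : EuclideanSpace ℝ (Fin 3), DifferentiableAt ℝ (v t) y := fun {t} ht y =>
    (analyticOnNhd_slice hcont (bdd_of_hasTypeITimeDecay hrate) hmild ht y (Set.mem_univ y)).differentiableAt
  -- ## the coordinates `T = dt`, `ℓ = dx_{b₀}`, `e = (0, e_{b₀})`, `f₀ = (1, 0)`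
  set T : ℝ × EuclideanSpace ℝ (Fin 3) →L[ℝ] ℝ := ContinuousLinearMap.fst ℝ ℝ (EuclideanSpace ℝ (Fin 3)) with hT
  set ℓ : ℝ × EuclideanSpace ℝ (Fin 3) →L[ℝ] ℝ :=
    (EuclideanSpace.proj b₀ : EuclideanSpace ℝ (Fin 3) →L[ℝ] ℝ).comp
      (ContinuousLinearMap.snd ℝ ℝ (EuclideanSpace ℝ (Fin 3))) with hℓ
  set e : ℝ × EuclideanSpace ℝ (Fin 3) := ((0 : ℝ), EuclideanSpace.single b₀ (1 : ℝ)) with he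
  set f₀ : ℝ × EuclideanSpace ℝ (Fin 3) := ((1 : ℝ), (0 : EuclideanSpace ℝ (Fin 3))) with hf₀
  have hℓe : ℓ e = 1 := by simp [hℓ, he]
  have hTe : T e = 0 := by simp [hT, he]
  have hTf : T f₀ = 1 := by simp [hT, hf₀]
  have hℓf : ℓ f₀ = 0 := by simp [hℓ, hf₀]
  -- ## hypotheses of the abstract lemma
  have hNc : ContDiffAt ℝ ω N (t₀, x₀) := (hNan _ haS).contDiffAt
  have hDc : ContDiffAt ℝ ω D (t₀, x₀) := (hDan _ haS).contDiffAt
  have hWc : ContDiffAt ℝ ω W (t₀, x₀) := (hWan _ haS).contDiffAt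
  have hnear : ∀ᶠ z in 𝓝 ((t₀, x₀) : ℝ × EuclideanSpace ℝ (Fin 3)),
      z ∈ Set.Iio (0 : ℝ) ×ˢ (Set.univ : Set (EuclideanSpace ℝ (Fin 3))) := hSo.mem_nhds haS
  have hDe : ∀ᶠ z in 𝓝 ((t₀, x₀) : ℝ × EuclideanSpace ℝ (Fin 3)), D z = fderiv ℝ W z e := by
    filter_upwards [hnear] with z hz
    have hz1 : z.1 < 0 := (Set.mem_prod.1 hz).1
    have hWd : DifferentiableAt ℝ W (z.1, z.2) := (hWan _ (by simpa using hz)).differentiableAt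
    rw [he, show z = (z.1, z.2) from rfl, ← FluidPDE.fderiv_slice_apply hWd]
    show fderiv ℝ (v z.1) z.2 (EuclideanSpace.single b₀ 1) 2 = fderiv ℝ (fun y => v z.1 y 2) z.2 (EuclideanSpace.single b₀ 1)
    rw [Literature.Analysis.FluidPDE.fderiv_apply_coord (hsd hz1 z.2)]
  have hDa : D (t₀, x₀) ≠ 0 := hpiv
  have hmin : ∀ᶠ z in 𝓝 ((t₀, x₀) : ℝ × EuclideanSpace ℝ (Fin 3)), ∀ h : ℝ × EuclideanSpace ℝ (Fin 3), T h = 0 → fderiv ℝ W z h = 0 →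
      D z * fderiv ℝ N z h - N z * fderiv ℝ D z h = 0 := by
    have hDne : ∀ᶠ z in 𝓝 ((t₀, x₀) : ℝ × EuclideanSpace ℝ (Fin 3)), D z ≠ 0 := hDc.continuousAt.eventually_ne hDa
    filter_upwards [hnear, hDne] with z hz hDz h hTh hWh
    have hz1 : z.1 < 0 := (Set.mem_prod.1 hz).1
    have hzS : (z.1, z.2) ∈ Set.Iio (0 : ℝ) ×ˢ (Set.univ : Set (EuclideanSpace ℝ (Fin 3))) := by simpa using hz
    have hh : h = ((0 : ℝ), h.2) := by
      ext
      · simpa [hT] using hTh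
      · rfl
    -- joint derivatives as slice derivatives
    have eN : fderiv ℝ N z h = fderiv ℝ (fun y => fderiv ℝ (v z.1) y (EuclideanSpace.single 2 1) b₀) z.2 h.2 := by
      rw [hh, show z = (z.1, z.2) from rfl, ← FluidPDE.fderiv_slice_apply (hNan _ hzS).differentiableAt]
    have eD : fderiv ℝ D z h = fderiv ℝ (fun y => fderiv ℝ (v z.1) y (EuclideanSpace.single b₀ 1) 2) z.2 h.2 := by
      rw [hh, show z = (z.1, z.2) from rfl, ← FluidPDE.fderiv_slice_apply (hDan _ hzS).differentiableAt]
    have eW : fderiv ℝ W z h = fderiv ℝ (fun y => v z.1 y 2) z.2 h.2 := by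
      rw [hh, show z = (z.1, z.2) from rfl, ← FluidPDE.fderiv_slice_apply (hWan _ hzS).differentiableAt]
    have eWb : fderiv ℝ (fun y => v z.1 y 2) z.2 (EuclideanSpace.single b₀ 1) = D z := by
      rw [Literature.Analysis.FluidPDE.fderiv_apply_coord (hsd hz1 z.2)]
    have hWu : fderiv ℝ (fun y => v z.1 y 2) z.2 h.2 = 0 := by rw [← eW]; exact hWh
    -- the slab minor with directions `(h.2, e_{b₀})`
    have hM := hmin z.1 hz1 b₀ hb₀ z.2 h.2 (EuclideanSpace.single b₀ 1)
    rw [hWu, eWb, mul_zero, sub_zero] at hM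
    rw [eN, eD]
    have h2 := (mul_eq_zero.1 hM).resolve_right hDz
    exact h2
  -- ## the structure function
  obtain ⟨G, hGc, hG⟩ := exists_slope_function₂ (n := ω) (by simp) hℓe hTe hTf hℓf hNc hDc hWc hDe hDa hmin
  have hGc' : ContDiffAt ℝ ω (Function.uncurry fun t w => G (t, w)) (t₀, v t₀ x₀ 2) := by
    have e1 : (Function.uncurry fun t w => G (t, w)) = G := by funext p; rfl
    rw [e1]
    simpa [hT, hW] using hGc
  -- an open neighbourhood on which the identity holds, inside the slab, with `D ≠ 0`
  have hDne : ∀ᶠ z in 𝓝 ((t₀, x₀) : ℝ × EuclideanSpace ℝ (Fin 3)), D z ≠ 0 := hDc.continuousAt.eventually_ne hDa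
  obtain ⟨O, hOsub, hOo, haO⟩ := _root_.mem_nhds_iff.1 (hG.and (hnear.and hDne))
  refine ⟨fun t w => G (t, w), hGc', O, hOo, haO, fun z hz => (hOsub hz).2.1, fun z hz b hb => ?_⟩
  obtain ⟨hGz, hzS, hDz⟩ := hOsub hz
  have hz1 : z.1 < 0 := (Set.mem_prod.1 hzS).1
  have hGz' : fderiv ℝ (v z.1) z.2 (EuclideanSpace.single 2 1) b₀ =
      G (z.1, v z.1 z.2 2) * fderiv ℝ (v z.1) z.2 (EuclideanSpace.single b₀ 1) 2 := by
    simpa [hN, hD, hW, hT] using hGz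
  rcases hcover b hb with rfl | rfl
  · exact hGz'
  · -- the other component from the wedge law `∂_z v₀·∂₁v₂ = ∂_z v₁·∂₀v₂`
    have hwedge := wedge_slice_of_class hrate hcont hmild hdiv hpol hz1 z.2
    have hDz' : fderiv ℝ (v z.1) z.2 (EuclideanSpace.single b₀ 1) 2 ≠ 0 := hDz
    -- case analysis on `(b₀, b) = (0,1)` or `(1,0)`
    have hcases : (b₀ = 0 ∧ b = 1) ∨ (b₀ = 1 ∧ b = 0) := by
      revert hb₀ hb hb01
      fin_cases b₀ <;> fin_cases b <;> simp
    rcases hcases with ⟨rfl, rfl⟩ | ⟨rfl, rfl⟩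
    · -- `∂_z v₁ = ∂_z v₀ ∂₁v₂ / ∂₀v₂ = G ∂₁ v₂`
      have h1 : fderiv ℝ (v z.1) z.2 (EuclideanSpace.single 2 1) 1 * fderiv ℝ (v z.1) z.2 (EuclideanSpace.single 0 1) 2 =
          G (z.1, v z.1 z.2 2) * fderiv ℝ (v z.1) z.2 (EuclideanSpace.single 1 1) 2 *
            fderiv ℝ (v z.1) z.2 (EuclideanSpace.single 0 1) 2 := by
        linear_combination (-1 : ℝ) * hwedge + fderiv ℝ (v z.1) z.2 (EuclideanSpace.single 1 1) 2 * hGz'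
      exact mul_right_cancel₀ hDz' h1
    · have h1 : fderiv ℝ (v z.1) z.2 (EuclideanSpace.single 2 1) 0 * fderiv ℝ (v z.1) z.2 (EuclideanSpace.single 1 1) 2 =
          G (z.1, v z.1 z.2 2) * fderiv ℝ (v z.1) z.2 (EuclideanSpace.single 0 1) 2 *
            fderiv ℝ (v z.1) z.2 (EuclideanSpace.single 1 1) 2 := by
        linear_combination hwedge + fderiv ℝ (v z.1) z.2 (EuclideanSpace.single 0 1) 2 * hGz'
      exact mul_right_cancel₀ hDz' h1

/-- ★ **AutS is an Aut clause.**  Class binders + divergence-free + poloidal + «all autonomy minors vanish on the backward slab» + ONE slab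
point `(t₀, x₀)` with `∇ₕv₂(t₀,x₀) ≠ 0` ⟹ the registered stub's LOCAL AUTONOMY CLAUSE holds on an open nonempty `W₁ ∋ (t₀,x₀)` of the slab:
`∃ g W₁, IsOpen W₁ ∧ W₁ ⊆ slab ∧ (t₀,x₀) ∈ W₁ ∧ ∀ z ∈ W₁, ∀ b ≠ 2, ∂_z v_b(z) = g(z.1, v₂ z)·∂_b v₂(z)`. [folklore] -/
theorem autClause_of_slab_minors (C : ℝ) (v : ℝ → EuclideanSpace ℝ (Fin 3) → EuclideanSpace ℝ (Fin 3))
    (hrate : Literature.Analysis.FluidPDE.HasTypeITimeDecay C v)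
    (hcont : ContinuousOn (Function.uncurry v) (Set.Iio (0 : ℝ) ×ˢ Set.univ))
    (hmild : ∀ s t : ℝ, s < t → t < 0 → ∀ x, v t x =
      Literature.Analysis.UnboundedOperators.heatExtension (v s) (t - s) x -
        Literature.Analysis.FluidPDE.oseenDuhamel 1 s v v t x)
    (hdiv : ∀ t < 0, Literature.Analysis.FluidPDE.VectorCalculus.IsDivFree (v t))
    (hpol : ∀ s < 0, ∀ y, ⟪Literature.Analysis.FluidPDE.curl (v s) y, EuclideanSpace.single 2 1⟫_ℝ = 0)
    (hmin : ∀ t < 0, ∀ b : Fin 3, b ≠ 2 → ∀ x p q : EuclideanSpace ℝ (Fin 3),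
      (fderiv ℝ (v t) x (EuclideanSpace.single b 1) 2 *
            fderiv ℝ (fun y => fderiv ℝ (v t) y (EuclideanSpace.single 2 1) b) x p -
          fderiv ℝ (v t) x (EuclideanSpace.single 2 1) b *
            fderiv ℝ (fun y => fderiv ℝ (v t) y (EuclideanSpace.single b 1) 2) x p) *
          fderiv ℝ (fun y => v t y 2) x q -
        (fderiv ℝ (v t) x (EuclideanSpace.single b 1) 2 *
            fderiv ℝ (fun y => fderiv ℝ (v t) y (EuclideanSpace.single 2 1) b) x q -
          fderiv ℝ (v t) x (EuclideanSpace.single 2 1) b *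
            fderiv ℝ (fun y => fderiv ℝ (v t) y (EuclideanSpace.single b 1) 2) x q) *
          fderiv ℝ (fun y => v t y 2) x p = 0)
    {t₀ : ℝ} (ht₀ : t₀ < 0) {x₀ : EuclideanSpace ℝ (Fin 3)}
    (hx₀ : fderiv ℝ (v t₀) x₀ (EuclideanSpace.single 0 1) 2 ≠ 0 ∨ fderiv ℝ (v t₀) x₀ (EuclideanSpace.single 1 1) 2 ≠ 0) :
    ∃ g : ℝ → ℝ → ℝ, ∃ W₁ : Set (ℝ × EuclideanSpace ℝ (Fin 3)), IsOpen W₁ ∧ W₁ ⊆ Set.Iio (0 : ℝ) ×ˢ Set.univ ∧ (t₀, x₀) ∈ W₁ ∧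
      ∀ z ∈ W₁, ∀ b : Fin 3, b ≠ 2 →
        fderiv ℝ (v z.1) z.2 (EuclideanSpace.single 2 1) b =
          g z.1 (v z.1 z.2 2) * fderiv ℝ (v z.1) z.2 (EuclideanSpace.single b 1) 2 := by
  obtain ⟨m, -, O, hOo, hxO, hOs, hslope⟩ :=
    slopeFunction_spaceTime_of_slab_minors C v hrate hcont hmild hdiv hpol hmin ht₀ hx₀
  exact ⟨m, O, hOo, hOs, hxO, hslope⟩

end Summit.NavierStokesRegularity.NavierStokesRegularity.Theorems.PoloidalWindowDoorPoloidalWindowRigidityZShockSlabMinorsAut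

end
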